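import Summits.QuantumFields.YangMills.Theorems.BalabanUVNodesK0S5FarSlotWeighted
import HarnessLib

/-!
# K0⁷ `stub_prop8StepCoP13` (stmt-QuantumFields-20541), sub-target S5 — **THE S5 SOCKET WITH A CONSUMER-CHOSEN NEAR CLASS**: [Balaban1985Variational] p. 301 (147)–(150) splits the top cube
# `□_k` of the collared sequence (144) into `□″_k^{(k)} = □_k ∩ Ω_k` (level `k`, the data `V′`) and `□′_k^{(k−1)} = □_k ∩ Λ_{k−1}` (kept at the record's FINER level `k − 1`, data `V̄′`),
# *«Ω′_j = □_j, j < k, Ω′_k = □″_k … a minimum in (150), because this space is defined by more restrictive functional conditions»*; the (160) near bound then holds *«for ⟨x,x′⟩ ∈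
# □′_k^{(k−1)} ∪ □″_k^{(k)}»* — NEAR CELLS AT TWO LEVELS — while the far cells are `ℭ_k ∖ □_k`; P12 (`j(c) = K − n` near, `j(c) < K − n ⇒ R′ ≤ distBI` far) cannot express that
# classification; this file re-types the socket with a predicate `near : BondIdx D → Prop`, both slots distance-weighted, the collar asked of the far cells only

Cell `pub-ymgap`, width seat `pub-ymgap-k0-s1-w3` gen 5 (HUMAN RULING D-0149; START LIST v11 §k0-s1; bus QUESTION «Q-CUBE-TOP» + CLAIM-3 of g5).  `--kind proof --supports
stmt-QuantumFields-20541 --as helper`; count-neutral; def-free; nothing restated (P11 `hRowsSep_of_adm22_T4`, FILE 1 `rows164_quarter_levelRadii_farW` ∕ `coef_nonneg_of_abs_le_mul`, g0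
`le_two_pow_mul_of_comparable`, P12 `two_le_exp_quarter` ∕ `h163_of_core` BY NAME).  FILE 1's `hbRows164_core_of_adm22_T4_farW` is the instance `near c :↔ j(c) = K − n` (kept; consumers
of the plain cube tower `cubeDomains` use it).

WHY.  The per-cube family of the heart must REFINE the record's family on the window (else the record's (82)-criticality does not give the Euler–Lagrange equation (133)∕(143)∕(158)
against `ker Q` of the per-cube family — S4's binder `h128 : Q_Vδ = 0 → …`); at a core plaquette next to `∂Ω_i` print therefore keeps `□′_i` at level `i − 1` ((148)∕(150)), and
the cells of `□′_i^{(i−1)}` are NEAR cells of LEVEL `i − 1` INSIDE the collar — neither «top level» nor «`R′`-far».  ym3-torus's `HalvingQuarterInterior` met the mirror case (top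
bonds crossing `∂□_k` are FAR).  (c)'s carrier lemma `rows164_quarter_levelRadii` is already generic in `near`; only the T4 socket fixed it.  Road-independent (R0′ ∕ R4), datum-independent.

WHAT IS PROVED (sorry-free; axioms standard; no definition).  `levelSep_or_top` (the (2.60) layer term `G·(k − j(c) − 1) ≤ d` holds below the top by P11's separation and reads
`−G ≤ 0 ≤ d` AT the top — far top-level cells cost nothing); ★★★ `hbRows164_core_of_adm22_T4_nearClassW (F : T4Family)` — P12's constants `M_h⁰, R₀, C, δ₀, δ₁, B₃` and binder block
with `near : BondIdx D → Prop` in place of the level test: NEAR `|X c| ≤ C_d·M_Δ·ε₁·L^{K−n−j(c)}·(distBI D b c + 1)` (any level — (160)'s weight `(L^{j(c)}η)⁻¹` of (161) displayed),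
FAR `R′ ≤ distBI D b c` ∧ `|X c| ≤ C_d·M_Δ·ε(j(c))·L^{K−n−j(c)}·(distBI D b c + 1)` (any level, top included), `8C_dCB₃e^{−δ₁R′} ≤ θ`, observation bond in the top domain ⇒ the four rows
`≤ ¼M_Δ·max{4C_dCB₃ε₁, θ·ε(K − n)}`; ★ `hbRows164_uniform_core_of_adm22_T4_nearClassW` (`ε ≡ ε₀`).
HONEST SCOPE: reals bookkeeping over this lineage's kernel-checked (161)⇒(164) chain; WHICH cells are near (the (148)∕(150) split, or `cubeDomains`' top level, or an interior class)
and the data sizes on them are the consumer's (S6 HEAD ∕ BRIDGE-92 data lane); the family `D` is any `Adm22` family — the split family itself (a `Domains` inhabitant with top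
`□_k ∩ Ω_k`) is NOT constructed here; nothing of [15]∕[6]∕[B6-II] asserted; `stub_prop8StepCoP13` ∕ K0⁷ NOT closed; N07 NOT discharged (5∕27 unmoved); one finite 𝕋⁴ programme at
fixed ε — R4 closes the conditional finite-𝕋⁴ rung `BalabanLadder.UV` ONLY; the YM mass gap (Clay) is NOT proved by any of this; nothing continuum ∕ ℝ⁴ ∕ OS.  No `def`, no `instance`,
no `notation`, no `sorry`.

References: T. Bałaban, CMP **102** (1985) 277–309 [Balaban1985Variational] (144) p.300, (147)–(150) p.301, (155) p.302, (160)–(163) p.303, (164) p.304; CMP **96** (1984) 223–250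
[Balaban1984PropagatorsII] (2.1)–(2.2) p.224, (2.60) p.234, Cor. 2.8 p.249; CMP **109** (1987) 249–301 [Balaban1987RG1] (0.1) p.251.
-/

set_option autoImplicit false

noncomputable section

open scoped BigOperators

namespace Summit.QuantumFields.YangMills.Theorems.K0S5NearClassSocket

open Literature.MathematicalPhysics.QuantumFieldTheory.Balaban1983to89
open B6SectADomainsV1 (Domains)
open B6SectAOperatorsV1 (BondIdx dcE dcsE)
open B11Eq161HBChainLevelRadii (le_two_pow_mul_of_comparable)
open T4Continuum (T4Family)
open Summit.QuantumFields.YangMills.Theorems.FlatCubeOpsText (Adm22 distBI)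
open Summit.QuantumFields.YangMills.Theorems.K0FlatCubeOpsTextP (IsLevWeight flatH levWeight_nonneg)
open Summit.QuantumFields.YangMills.Theorems.K0FlatHBBound164P (bondIdx_level_le)
open Summit.QuantumFields.YangMills.Theorems.K0FlatPortKernelRowsSepP (hRowsSep_of_adm22_T4)
open Summit.QuantumFields.YangMills.Theorems.K0S5HBRows164CoreCubeSeq (two_le_exp_quarter h163_of_core)
open Summit.QuantumFields.YangMills.Theorems.HalvingQuarterCubeSeq (distBI_nonneg)
open Summit.QuantumFields.YangMills.Theorems.K0S5FarSlotWeighted (rows164_quarter_levelRadii_farW coef_nonneg_of_abs_le_mul)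

/-- `G ≥ 0`, `d ≥ 0`, `j ≤ k` and either `j < k` with the layer separation `G·(k − j − 1) ≤ d`, or `j = k`: in all cases `G·(k − j − 1) ≤ d` (at `j = k` the left side is `−G ≤ 0`).
[cite: Balaban1984PropagatorsII, (2.60) p.234, bookkeeping] -/
theorem levelSep_or_top {G d : ℝ} {k j : ℕ} (hG : 0 ≤ G) (hd : 0 ≤ d) (hjk : j ≤ k)
    (hsep : j < k → G * ((k : ℝ) - (j : ℕ) - (1 : ℕ)) ≤ d) : G * ((k : ℝ) - (j : ℕ) - (1 : ℕ)) ≤ d := by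
  rcases lt_or_eq_of_le hjk with hlt | heq
  · exact hsep hlt
  · subst heq
    have : G * ((j : ℝ) - (j : ℕ) - (1 : ℕ)) = -G := by push_cast; ring
    rw [this]
    linarith

/-- ★★★ **(164) FOR THE CANONICAL FLAT `H` OF EVERY ADMISSIBLE FAMILY ON NODE 00's FOUR-TORI — THE NEAR CLASS A CONSUMER-CHOSEN PREDICATE, BOTH SLOTS DISTANCE-WEIGHTED** (the generic
shape of (c)'s `rows164_quarter_levelRadii` carried to the T4 socket; FILE 1's `hbRows164_core_of_adm22_T4_farW` is the instance `near c :↔ j(c) = K − n`): P12's constants and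
binder block, with a predicate `near : BondIdx D → Prop` in place of the level test — NEAR cells (any level `j(c) ≤ K − n`; print's (160) holds «for ⟨x,x′⟩ ∈ □′_k^{(k−1)} ∪ □″_k^{(k)}»,
i.e. on the top cube at BOTH levels `k` and `k − 1` under the (148)∕(150) split) carry `|X c| ≤ C_d·M_Δ·ε₁·L^{K−n−j(c)}·(distBI D b c + 1)`; FAR cells carry the core collar
`R′ ≤ distBI D b c` and `|X c| ≤ C_d·M_Δ·ε(j(c))·L^{K−n−j(c)}·(distBI D b c + 1)` (far top-level cells — e.g. top bonds crossing `∂□_k`, ym3-torus `HalvingQuarterInterior`'s located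
class — are allowed: the (2.60) layer term is `−G ≤ 0` there and the tilt costs nothing); conclusion the four rows `≤ ¼M_Δ·max{4C_dCB₃ε₁, θ·ε(K − n)}` at every `b` with
`D.InOm (K − n) b₋`. [cite: Balaban1985Variational, (144) p.300, (147)–(150) p.301, (155) p.302, (160)–(164) pp.303–304; Balaban1984PropagatorsII, (2.1)–(2.2) p.224, (2.60) p.234, Cor. 2.8 p.249; Balaban1987RG1, (0.1) p.251] -/
theorem hbRows164_core_of_adm22_T4_nearClassW (F : T4Family) :
    ∃ (Mh₀ R₀ : ℕ) (C δ₀ δ₁ B₃ : ℝ), 0 ≤ C ∧ 0 < δ₀ ∧ 0 < δ₁ ∧ 0 < B₃ ∧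
    ∀ (n K : ℕ) (_ : 1 ≤ K - n) (_ : K - n + 1 ≤ F.m + K) {Mh R a' : ℕ} (_ : Mh = F.L ^ a') (_ : Mh₀ ≤ Mh) (_ : R₀ ≤ R) (_ : a' + 3 ≤ F.m + n)
      (D : Domains (F.P K)) (_ : D.k = K - n) (_ : Adm22 D R (F.L * Mh))
      (w : ℕ → PBond (F.P K) 0 → ℝ) (_ : IsLevWeight (F.P K) (K - n) D w)
      {Cd MΔ ε₁ θ R' : ℝ} {ε : ℕ → ℝ}
      (_ : 0 ≤ Cd) (_ : 0 ≤ MΔ) (_ : 0 ≤ ε₁) (_ : 0 ≤ ε (K - n)) (_ : ∀ j, j < K - n → ε j ≤ 2 * ε (j + 1))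
      (_ : 8 * Cd * C * B₃ * Real.exp (-(δ₁ * R')) ≤ θ)
      (near : BondIdx D → Prop) {X : BondIdx D → ℝ} {b : PBond (F.P K) 0}
      (_ : D.InOm (K - n) b.src) (_ : ∀ c : BondIdx D, ¬ near c → R' ≤ distBI D b c)
      (_ : ∀ c, near c → |X c| ≤ Cd * MΔ * ε₁ * ((F.P K).L : ℝ) ^ ((K - n) - (c.1.1 : ℕ)) * (distBI D b c + 1))
      (_ : ∀ c, ¬ near c → |X c| ≤ Cd * MΔ * ε (c.1.1 : ℕ) * ((F.P K).L : ℝ) ^ ((K - n) - (c.1.1 : ℕ)) * (distBI D b c + 1)),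
      w 1 b * (w 1 b * |flatH (F.P K) (K - n) D X b|) ≤
        1 / 4 * MΔ * max (4 * Cd * C * B₃ * ε₁) (θ * ε (K - n)) ∧
      (∀ ν : Fin (F.P K).d, w 1 b * (w 2 b * ((F.P K).L : ℝ) ^ (K - n) *
          |flatH (F.P K) (K - n) D X ⟨b.src.shift ν, b.dir⟩ -
            flatH (F.P K) (K - n) D X b|) ≤
        1 / 4 * MΔ * max (4 * Cd * C * B₃ * ε₁) (θ * ε (K - n))) ∧
      w 1 b * (w 3 b * |(dcsE (((F.P K).L : ℝ) ^ (K - n)) (dcE (((F.P K).L : ℝ) ^ (K - n))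
          (WithLp.toLp 2 (flatH (F.P K) (K - n) D X)))) b|) ≤
        1 / 4 * MΔ * max (4 * Cd * C * B₃ * ε₁) (θ * ε (K - n)) ∧
      w 1 b * (w 3 b * (((F.P K).L : ℝ) ^ (K - n)) ^ 2 *
          |∑ ν : Fin (F.P K).d, ((flatH (F.P K) (K - n) D X b -
              flatH (F.P K) (K - n) D X ⟨b.src.shift ν, b.dir⟩) +
            (flatH (F.P K) (K - n) D X b -
              flatH (F.P K) (K - n) D X ⟨b.src.unshift ν, b.dir⟩))|) ≤
        1 / 4 * MΔ * max (4 * Cd * C * B₃ * ε₁) (θ * ε (K - n)) := by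
  obtain ⟨Mh₀, R₀, C, δ₀, B₃, hC, hδ₀, hB₃, hmain⟩ := hRowsSep_of_adm22_T4 F
  refine ⟨Mh₀, max R₀ (⌈4 * Real.log 2 / δ₀⌉₊ + 2), C, δ₀, δ₀ / 4, B₃, hC, hδ₀, div_pos hδ₀ four_pos, hB₃, ?_⟩
  intro n K hk1 hk' Mh R a' hMha hMh hR hsize D hDk hAdm w hw Cd MΔ ε₁ θ R' ε hCd hMΔ hε₁ hεk hcomp h163 near X b hbΩ hcollar hnear hfar
  have hR₀ : R₀ ≤ R := le_trans (le_max_left _ _) hR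
  obtain ⟨-, -, dBI, hcompD, hsep, hrow, hdec⟩ := hmain n K hk1 hk' hMha hMh hR₀ hsize D hDk hAdm w hw
  -- `1 ≤ L·M_h`
  have hM : 1 ≤ F.L * Mh := by
    rw [hMha]
    exact Nat.one_le_iff_ne_zero.mpr (Nat.mul_ne_zero (by have := F.hL11; omega) (pow_ne_zero _ (by have := F.hL11; omega)))
  -- the per-layer gap `G₀ = R·L·M_h − 1 ≥ 0` and the tilt `τ = ¼δ₀`
  set G₀ : ℝ := ((R * (F.L * Mh) - 1 : ℕ) : ℝ) with hG₀def
  have hG₀0 : 0 ≤ G₀ := by rw [hG₀def]; exact Nat.cast_nonneg _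
  have hRq : ⌈4 * Real.log 2 / δ₀⌉₊ + 2 ≤ R := le_trans (le_max_right _ _) hR
  have hRM : R ≤ R * (F.L * Mh) := Nat.le_mul_of_pos_right R hM
  have hnat : ⌈4 * Real.log 2 / δ₀⌉₊ + 1 ≤ R * (F.L * Mh) - 1 := by omega
  have hG₀ : 4 * Real.log 2 / δ₀ ≤ G₀ := by
    have h1 : (4 * Real.log 2 / δ₀ : ℝ) ≤ ⌈4 * Real.log 2 / δ₀⌉₊ := Nat.le_ceil _
    have h2 : ((⌈4 * Real.log 2 / δ₀⌉₊ + 1 : ℕ) : ℝ) ≤ G₀ := by rw [hG₀def]; exact_mod_cast hnat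
    push_cast at h2
    linarith
  have h2 : 2 ≤ Real.exp (δ₀ / 4 * G₀) := two_le_exp_quarter hδ₀ hG₀
  have hτ : (0 : ℝ) ≤ δ₀ / 4 := by positivity
  have hτδ : δ₀ / 4 ≤ δ₀ / 2 := by linarith
  have h163' := h163_of_core h163
  have hd0 : ∀ c, 0 ≤ dBI b c := fun c => (distBI_nonneg _ b c).trans (hcompD b c)
  refine rows164_quarter_levelRadii_farW hdec hrow hC hCd hMΔ hε₁ hεk (fun _ hj => le_two_pow_mul_of_comparable hcomp hj) hτ hτδ h2 h163'
    near (levWeight_nonneg hw 1 b) hd0 (bondIdx_level_le hDk) ?_ ?_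
  · -- NEAR cells: (160) with its level weight, transported along `distBI ≤ dBI` (the coefficient is `≥ 0` as soon as the hypothesis holds)
    intro c hc
    have h := hnear c hc
    have hcoef : 0 ≤ Cd * MΔ * ε₁ * ((F.P K).L : ℝ) ^ ((K - n) - (c.1.1 : ℕ)) := coef_nonneg_of_abs_le_mul (distBI_nonneg D b c) h
    calc |X c| ≤ Cd * MΔ * ε₁ * ((F.P K).L : ℝ) ^ ((K - n) - (c.1.1 : ℕ)) * (dBI b c + 1) :=
          h.trans (mul_le_mul_of_nonneg_left (by linarith [hcompD b c]) hcoef)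
      _ = Cd * MΔ * ε₁ * ((dBI b c + 1) * ((F.P K).L : ℝ) ^ ((K - n) - (c.1.1 : ℕ))) := by ring
  · -- FAR cells: the weighted (155), the consumer's collar, and the (2.60) layer term — P11's exported separation below the top, `−G₀ ≤ 0` at the top
    intro c hc
    have h := hfar c hc
    have hcoef : 0 ≤ Cd * MΔ * ε (c.1.1 : ℕ) * ((F.P K).L : ℝ) ^ ((K - n) - (c.1.1 : ℕ)) :=
      coef_nonneg_of_abs_le_mul (distBI_nonneg D b c) h
    refine ⟨h.trans (mul_le_mul_of_nonneg_left (by linarith [hcompD b c]) hcoef), (hcollar c hc).trans (hcompD b c), ?_⟩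
    refine levelSep_or_top hG₀0 (hd0 c) (bondIdx_level_le hDk c) fun hlt => ?_
    have hs := hsep (K - n) b c le_rfl hbΩ hlt
    simpa [hG₀def] using hs

/-- ★ **THE SAME WITH PRINT'S UNIFORM FAR RADIUS** (`ε ≡ ε₀ ≥ 0`): conclusion `≤ ¼M_Δ·max{4C_dCB₃·ε₁, θ·ε₀}` (print's (164) at `θ = ½`).
[cite: Balaban1985Variational, (151)–(155) pp.301–302, (160)–(164) pp.303–304] -/
theorem hbRows164_uniform_core_of_adm22_T4_nearClassW (F : T4Family) :
    ∃ (Mh₀ R₀ : ℕ) (C δ₀ δ₁ B₃ : ℝ), 0 ≤ C ∧ 0 < δ₀ ∧ 0 < δ₁ ∧ 0 < B₃ ∧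
    ∀ (n K : ℕ) (_ : 1 ≤ K - n) (_ : K - n + 1 ≤ F.m + K) {Mh R a' : ℕ} (_ : Mh = F.L ^ a') (_ : Mh₀ ≤ Mh) (_ : R₀ ≤ R) (_ : a' + 3 ≤ F.m + n)
      (D : Domains (F.P K)) (_ : D.k = K - n) (_ : Adm22 D R (F.L * Mh))
      (w : ℕ → PBond (F.P K) 0 → ℝ) (_ : IsLevWeight (F.P K) (K - n) D w)
      {Cd MΔ ε₁ θ R' ε₀ : ℝ}
      (_ : 0 ≤ Cd) (_ : 0 ≤ MΔ) (_ : 0 ≤ ε₁) (_ : 0 ≤ ε₀)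
      (_ : 8 * Cd * C * B₃ * Real.exp (-(δ₁ * R')) ≤ θ)
      (near : BondIdx D → Prop) {X : BondIdx D → ℝ} {b : PBond (F.P K) 0}
      (_ : D.InOm (K - n) b.src) (_ : ∀ c : BondIdx D, ¬ near c → R' ≤ distBI D b c)
      (_ : ∀ c, near c → |X c| ≤ Cd * MΔ * ε₁ * ((F.P K).L : ℝ) ^ ((K - n) - (c.1.1 : ℕ)) * (distBI D b c + 1))
      (_ : ∀ c, ¬ near c → |X c| ≤ Cd * MΔ * ε₀ * ((F.P K).L : ℝ) ^ ((K - n) - (c.1.1 : ℕ)) * (distBI D b c + 1)),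
      w 1 b * (w 1 b * |flatH (F.P K) (K - n) D X b|) ≤
        1 / 4 * MΔ * max (4 * Cd * C * B₃ * ε₁) (θ * ε₀) ∧
      (∀ ν : Fin (F.P K).d, w 1 b * (w 2 b * ((F.P K).L : ℝ) ^ (K - n) *
          |flatH (F.P K) (K - n) D X ⟨b.src.shift ν, b.dir⟩ -
            flatH (F.P K) (K - n) D X b|) ≤
        1 / 4 * MΔ * max (4 * Cd * C * B₃ * ε₁) (θ * ε₀)) ∧
      w 1 b * (w 3 b * |(dcsE (((F.P K).L : ℝ) ^ (K - n)) (dcE (((F.P K).L : ℝ) ^ (K - n))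
          (WithLp.toLp 2 (flatH (F.P K) (K - n) D X)))) b|) ≤
        1 / 4 * MΔ * max (4 * Cd * C * B₃ * ε₁) (θ * ε₀) ∧
      w 1 b * (w 3 b * (((F.P K).L : ℝ) ^ (K - n)) ^ 2 *
          |∑ ν : Fin (F.P K).d, ((flatH (F.P K) (K - n) D X b -
              flatH (F.P K) (K - n) D X ⟨b.src.shift ν, b.dir⟩) +
            (flatH (F.P K) (K - n) D X b -
              flatH (F.P K) (K - n) D X ⟨b.src.unshift ν, b.dir⟩))|) ≤
        1 / 4 * MΔ * max (4 * Cd * C * B₃ * ε₁) (θ * ε₀) := by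
  obtain ⟨Mh₀, R₀, C, δ₀, δ₁, B₃, hC, hδ₀, hδ₁, hB₃, hmain⟩ := hbRows164_core_of_adm22_T4_nearClassW F
  refine ⟨Mh₀, R₀, C, δ₀, δ₁, B₃, hC, hδ₀, hδ₁, hB₃, ?_⟩
  intro n K hk1 hk' Mh R a' hMha hMh hR hsize D hDk hAdm w hw Cd MΔ ε₁ θ R' ε₀ hCd hMΔ hε₁ hε₀ h163 near X b hbΩ hcollar hnear hfar
  exact hmain n K hk1 hk' hMha hMh hR hsize D hDk hAdm w hw (ε := fun _ => ε₀) hCd hMΔ hε₁ hε₀ (fun j _ => by linarith) h163 near hbΩ hcollar hnear hfar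

end Summit.QuantumFields.YangMills.Theorems.K0S5NearClassSocket

end
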